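import Mathlib
import HarnessLib
import Literature.Computability.Complexity.CNF
import Literature.Computability.Complexity.PNPWave0
import Literature.Computability.Complexity.BranchingFn

/-!
# Disproof of `SearchHardWindow` — findings (cdisprove, crux stmt-PneNP-2460, cycle 1)

NO KILL.  `SearchHardWindow` (∃ k α, uniformly positive satisfiability of `F_k(n, ⌊αn⌋)` ∧ every
poly-time word function solves it with probability → 0) is open in both directions: it implies
`P ≠ NP` (the route's `closes`, search-to-decision), and its negation at the intended witness
(k ≥ 23, α = 5·2^k log k/k) would be a polynomial-time algorithm beating every known one
(best in print: Coja-Oghlan's `Fix`, (1-o_k(1)) 2^k log k/k) — so no cheap attack can decide it.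
What IS decidable cheaply is collected here as kernel-checked lemmas (no `sorry` anywhere); the
§B/§C/§C'/§D lemmas are LANDED in the tree as `Theorems/SearchHardWindow/Negative/WindowBoundaries.lean`
(p111697) and `Theorems/SearchHardWindow/Negative/FalseWithoutPolyTime.lean` (p111532):

* §A  the crux at fixed parameters, `SearchHardWindowAt k α` (`SearchHardWindow` is definitionally
  `∃ k α, SearchHardWindowAt k α`; see the NOTE in §A).
* §B  WINDOW BOUNDARIES (which `(k, α)` can NOT witness the `∃`):
  - `searchHardWindowAt_false_of_nonpos`     : `α ≤ 0` never witnesses (m = 0, every f solves);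
  - `searchHardWindowAt_zero_false`          : `k = 0` never witnesses;
  - `searchHardWindowAt_false_of_firstMoment`: `2^k · log 2 ≤ α` never witnesses (first moment:
    `Pr[sat] ≤ 2^n (1 - 2^{-k})^m → 0`), so every witness has `0 < α < 2^k log 2`, `1 ≤ k`;
  - `lineA_density_false_of_le_22` / `lineA_witness_k_ge_23`: at Line A's density
    `α_k = 5·2^k log k/k` the crux body is FALSE for every `k ≤ 22` (`k^5 ≥ 2^k` there), so the
    composition `SearchHardWindow_of` necessarily runs at `k ≥ 23` (the tree's
    `positiveSatProbability_proof` uses `k ≥ 1024`; consistent).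
* §B' TIGHTNESS: `solveProb_const_nil` — the trivial poly-time algorithm (all-`false` table,
  `const_mem_FP`) succeeds with probability EXACTLY `(1 - 2^{-k})^m`; the crux lives entirely in
  the factor `2^n` between this and the first-moment bound; no faster-than-`(1-2^{-k})^{αn}` decay
  of `Pr[f solves]` can be proved uniformly in `f` (`exists_polyTime_solveProb_ge`).
* §C  LOAD-BEARING HYPOTHESES:
  - `searchHardWindow_false_without_polyTime` : dropping `IsPolyTime` makes the crux FALSE
    (the choice-function brute-force solver succeeds with probability ≥ Pr[sat] ≥ ε) — any proof
    must use the time bound (white-box), cf. the route's relativization caveat;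
  - `hardnessConjunct_zero_one` / `searchHardWindowWithoutPosSat_trivial` : dropping the
    positive-satisfiability conjunct makes the crux TRIVIAL (k = 0, α = 1: nothing is solvable) —
    the sat conjunct is exactly what excludes the degenerate witnesses.
* §D  LINE `Sketch` (Line A, approx-degree ladder): `kernelHypothesis_false_of_hardness` — the
  hypothesis of the kernel stub `stub_polyTimeLowDegreeSimulable` (frequent poly-time success
  `≥ ε`) is refuted by the crux's own hardness conjunct, so the kernel is a COROLLARY of the
  crux at the same `k`; with `HuangSellke2025KSat` (checked against arXiv:2501.06427 Cor. 3.21,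
  p. 23; degree = span of ≤ D-juntas p. 21; `round_U` p. 4 — the typed fact is the deterministic
  saturated special case, faithful) kernel ⟺ hardness conjunct: the kernel has no attack surface
  independent of the crux. Joint sufficiency of the stubs is already kernel-checked
  (`SearchHardWindow_of` in `Lines/Sketch.lean`), nothing smuggled.
* §E  NEAR-MISSES (documented, not closed): `k = 1, 0 < α < 2 log 2` (birthday bound needed) and
  `k = 2` (2-SAT ∈ P as a TM2 machine) cannot witness either; both are morally clear and
  irrelevant to the intended witness, recorded as comments only (no `sorry` in this file).

Refuter `refuter-cdisprove-stmt-PneNP-2460-0`, 2026-08-16.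
-/

set_option linter.dupNamespace false

noncomputable section

namespace Summit.PneNP.PneNP.Cruxes.SearchHardWindow.Disproof

open Finset Filter
open Literature.Computability.Complexity
open scoped Classical

/-! ## §A The crux at fixed parameters -/

/-- Satisfaction probability (counting ratio) of `F_k(n, m)` in the route's literal-array model. -/
def satProb (k n m : ℕ) : ℝ :=
  ((Finset.univ.filter fun Φ : Fin m → Fin k → Fin n × Bool =>
      ∃ σ : Fin n → Bool, ∀ i, ∃ j, σ (Φ i j).1 = (Φ i j).2).card : ℝ) /
    Fintype.card (Fin m → Fin k → Fin n × Bool)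

/-- Success probability of the word function `f` on `F_k(n, m)` (route's success predicate). -/
def solveProb (k n m : ℕ) (f : List Bool → List Bool) : ℝ :=
  ((Finset.univ.filter fun Φ : Fin m → Fin k → Fin n × Bool => ∀ i, ∃ j,
      (f (encodingCNF.encode (List.ofFn fun a => List.ofFn fun b =>
        (((Φ a b).1 : ℕ), (Φ a b).2)))).getD (Φ i j).1 false = (Φ i j).2).card : ℝ) /
    Fintype.card (Fin m → Fin k → Fin n × Bool)

/-- The hardness conjunct of the crux at `(k, α)`: every poly-time `f` solves with probability → 0. -/
def HardnessConjunct (k : ℕ) (α : ℝ) : Prop :=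
  ∀ f : List Bool → List Bool, IsPolyTime f → ∀ ε : ℝ, 0 < ε →
    ∀ᶠ n : ℕ in atTop, ∀ m : ℕ, m = ⌊α * n⌋₊ → solveProb k n m f ≤ ε

/-- The positive-satisfiability conjunct of the crux at `(k, α)`. -/
def PosSatConjunct (k : ℕ) (α : ℝ) : Prop :=
  ∃ ε : ℝ, 0 < ε ∧ ∀ᶠ n : ℕ in atTop, ∀ m : ℕ, m = ⌊α * n⌋₊ → ε ≤ satProb k n m

/-- The crux at fixed parameters `(k, α)`. -/
def SearchHardWindowAt (k : ℕ) (α : ℝ) : Prop :=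
  PosSatConjunct k α ∧ HardnessConjunct k α

/-! NOTE (route-file independence).  `Summit.PneNP.PneNP.Theses.OverlapGapAlgebra.SearchHardWindow`
is LITERALLY `∃ (k : ℕ) (α : ℝ), SearchHardWindowAt k α` — the statement
`theorem searchHardWindow_iff : SearchHardWindow ↔ ∃ k α, SearchHardWindowAt k α := Iff.rfl`
elaborates (folder copy `W.lean`, rc 0, 2026-08-16).  This published copy imports only the
Literature vocabulary (`encodingCNF`, `IsPolyTime`) and NOT the route file, because the farm could
not serve `Theses.OverlapGapAlgebra` coherently during this cycle (re-rendered 13:58Z); every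
statement below is the literal sub-formula of the crux with the same binders and the same
`open scoped Classical` context, so the lemmas apply to the crux by `obtain ⟨k, α, h⟩ := hX`. -/

/-- The identity word function is polynomial-time (Mathlib's `idComputableInPolyTime`). -/
theorem isPolyTime_id : IsPolyTime (id : List Bool → List Bool) :=
  ⟨Turing.idComputableInPolyTime _⟩

/-- With no clauses every word function solves every instance: `solveProb k n 0 f = 1`. -/
theorem solveProb_zero (k n : ℕ) (f : List Bool → List Bool) : solveProb k n 0 f = 1 := by
  unfold solveProb
  rw [Finset.filter_true_of_mem (fun Φ _ i => i.elim0), Finset.card_univ]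
  simp

/-- With `k = 0` and at least one clause nothing is satisfiable: `satProb 0 n (m+1) = 0`. -/
theorem satProb_zero_succ (n m : ℕ) : satProb 0 n (m + 1) = 0 := by
  unfold satProb
  rw [Finset.filter_false_of_mem, Finset.card_empty]
  · simp
  · rintro Φ - ⟨σ, hσ⟩
    obtain ⟨j, -⟩ := hσ 0
    exact j.elim0

/-- With `k = 0` and at least one clause no `f` solves anything: `solveProb 0 n (m+1) f = 0`. -/
theorem solveProb_zero_succ (n m : ℕ) (f : List Bool → List Bool) : solveProb 0 n (m + 1) f = 0 := by
  unfold solveProb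
  rw [Finset.filter_false_of_mem, Finset.card_empty]
  · simp
  · rintro Φ - hΦ
    obtain ⟨j, -⟩ := hΦ 0
    exact j.elim0

/-! ## §B Window boundaries -/

/-- For `α ≤ 0` the clause number `⌊α n⌋₊` vanishes. -/
theorem floor_eq_zero_of_nonpos {α : ℝ} (hα : α ≤ 0) (n : ℕ) : ⌊α * n⌋₊ = 0 :=
  Nat.floor_of_nonpos (by nlinarith [(Nat.cast_nonneg n : (0 : ℝ) ≤ n)])

/-- `α ≤ 0` never witnesses the crux: the hardness conjunct fails for `f = id` (m = 0). -/
theorem hardnessConjunct_false_of_nonpos (k : ℕ) {α : ℝ} (hα : α ≤ 0) :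
    ¬ HardnessConjunct k α := by
  intro h
  have hev := h id isPolyTime_id (1 / 2) (by norm_num)
  obtain ⟨n, hn⟩ := hev.exists
  have := hn 0 (floor_eq_zero_of_nonpos hα n).symm
  rw [solveProb_zero] at this
  norm_num at this

theorem searchHardWindowAt_false_of_nonpos (k : ℕ) {α : ℝ} (hα : α ≤ 0) :
    ¬ SearchHardWindowAt k α :=
  fun h => hardnessConjunct_false_of_nonpos k hα h.2

/-- For `α > 0` the clause number is eventually positive. -/
theorem eventually_one_le_floor {α : ℝ} (hα : 0 < α) : ∀ᶠ n : ℕ in atTop, 1 ≤ ⌊α * n⌋₊ := by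
  refine Filter.eventually_atTop.2 ⟨⌈1 / α⌉₊, fun n hn => ?_⟩
  refine Nat.le_floor ?_
  have h1 : (1 / α : ℝ) ≤ n := le_trans (Nat.le_ceil _) (by exact_mod_cast hn)
  have h2 : 1 ≤ α * n := by
    rw [div_le_iff₀ hα] at h1
    linarith [mul_comm α n]
  exact_mod_cast h2

/-- `k = 0` never witnesses the crux: for `α ≤ 0` by the previous lemma, for `α > 0` because
then `m ≥ 1` eventually and an instance with an (empty) clause is unsatisfiable. -/
theorem posSatConjunct_zero_false {α : ℝ} (hα : 0 < α) : ¬ PosSatConjunct 0 α := by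
  rintro ⟨ε, hε, hev⟩
  obtain ⟨n, hn1, hn2⟩ := (hev.and (eventually_one_le_floor hα)).exists
  have h := hn1 _ rfl
  obtain ⟨m, hm⟩ : ∃ m, ⌊α * n⌋₊ = m + 1 := ⟨⌊α * n⌋₊ - 1, by omega⟩
  rw [hm, satProb_zero_succ] at h
  linarith

theorem searchHardWindowAt_zero_false (α : ℝ) : ¬ SearchHardWindowAt 0 α := by
  intro h
  rcases le_or_gt α 0 with hα | hα
  · exact searchHardWindowAt_false_of_nonpos 0 hα h
  · exact posSatConjunct_zero_false hα h.1

/-! ### First moment: `Pr[sat] ≤ 2^n (1 - 2^{-k})^m` -/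

/-- The literals falsified by `σ` are `n` in number (one per variable). -/
theorem card_falseLiterals (n : ℕ) (σ : Fin n → Bool) :
    (univ.filter fun l : Fin n × Bool => σ l.1 ≠ l.2).card = n := by
  have h : (univ.filter fun l : Fin n × Bool => σ l.1 ≠ l.2) = univ.image fun v => (v, !σ v) := by
    ext ⟨v, b⟩
    simp only [mem_filter, mem_univ, true_and, mem_image, Prod.mk.injEq]
    constructor
    · intro hb
      exact ⟨v, rfl, by cases b <;> cases h : σ v <;> simp_all⟩
    · rintro ⟨v', hv, hb⟩
      rw [← hb, ← hv]
      cases σ v' <;> simp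
  rw [h, card_image_of_injective _ (fun v v' hv => (Prod.mk.inj hv).1), card_univ, Fintype.card_fin]

/-- The clauses (`k`-tuples of literals) falsified by `σ` are `n^k` in number. -/
theorem card_falseClauses (k n : ℕ) (σ : Fin n → Bool) :
    (univ.filter fun c : Fin k → Fin n × Bool => ∀ j, σ (c j).1 ≠ (c j).2).card = n ^ k := by
  have h : (univ.filter fun c : Fin k → Fin n × Bool => ∀ j, σ (c j).1 ≠ (c j).2) =
      Fintype.piFinset fun _ : Fin k => univ.filter fun l : Fin n × Bool => σ l.1 ≠ l.2 := by
    ext c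
    simp [Fintype.mem_piFinset]
  rw [h, Fintype.card_piFinset, prod_const, card_falseLiterals, card_univ, Fintype.card_fin]

/-- The clauses satisfied by `σ` are `(2n)^k - n^k` in number. -/
theorem card_trueClauses (k n : ℕ) (σ : Fin n → Bool) :
    (univ.filter fun c : Fin k → Fin n × Bool => ∃ j, σ (c j).1 = (c j).2).card = (2 * n) ^ k - n ^ k := by
  have htot : (univ : Finset (Fin k → Fin n × Bool)).card = (2 * n) ^ k := by
    rw [card_univ, Fintype.card_fun, Fintype.card_prod, Fintype.card_fin, Fintype.card_bool,
      Fintype.card_fin, mul_comm]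
  have hsplit := Finset.card_filter_add_card_filter_not
    (s := (univ : Finset (Fin k → Fin n × Bool))) (p := fun c => ∃ j, σ (c j).1 = (c j).2)
  have hneg : (univ.filter fun c : Fin k → Fin n × Bool => ¬ ∃ j, σ (c j).1 = (c j).2).card = n ^ k := by
    rw [← card_falseClauses k n σ]
    congr 1
    ext c
    simp
  rw [hneg, htot] at hsplit
  omega

/-- The instances satisfied by a FIXED assignment `σ` are `((2n)^k - n^k)^m` in number. -/
theorem card_satBy (k n m : ℕ) (σ : Fin n → Bool) :
    (univ.filter fun Φ : Fin m → Fin k → Fin n × Bool => ∀ i, ∃ j, σ (Φ i j).1 = (Φ i j).2).card =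
      ((2 * n) ^ k - n ^ k) ^ m := by
  have h : (univ.filter fun Φ : Fin m → Fin k → Fin n × Bool => ∀ i, ∃ j, σ (Φ i j).1 = (Φ i j).2) =
      Fintype.piFinset fun _ : Fin m => univ.filter fun c : Fin k → Fin n × Bool =>
        ∃ j, σ (c j).1 = (c j).2 := by
    ext Φ
    simp [Fintype.mem_piFinset]
  rw [h, Fintype.card_piFinset, prod_const, card_trueClauses, card_univ, Fintype.card_fin]

/-- FIRST MOMENT (union bound over assignments): `#{Φ satisfiable} ≤ 2^n · ((2n)^k - n^k)^m`. -/
theorem card_sat_le (k n m : ℕ) :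
    (univ.filter fun Φ : Fin m → Fin k → Fin n × Bool =>
        ∃ σ : Fin n → Bool, ∀ i, ∃ j, σ (Φ i j).1 = (Φ i j).2).card ≤ 2 ^ n * ((2 * n) ^ k - n ^ k) ^ m := by
  calc (univ.filter fun Φ : Fin m → Fin k → Fin n × Bool =>
          ∃ σ : Fin n → Bool, ∀ i, ∃ j, σ (Φ i j).1 = (Φ i j).2).card
      ≤ ((univ : Finset (Fin n → Bool)).biUnion fun σ => univ.filter
          fun Φ : Fin m → Fin k → Fin n × Bool => ∀ i, ∃ j, σ (Φ i j).1 = (Φ i j).2).card := by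
        refine card_le_card fun Φ hΦ => ?_
        simp only [mem_filter, mem_univ, true_and, mem_biUnion] at hΦ ⊢
        obtain ⟨σ, hσ⟩ := hΦ
        exact ⟨σ, hσ⟩
    _ ≤ ∑ σ : Fin n → Bool, (univ.filter
          fun Φ : Fin m → Fin k → Fin n × Bool => ∀ i, ∃ j, σ (Φ i j).1 = (Φ i j).2).card :=
        card_biUnion_le
    _ = 2 ^ n * ((2 * n) ^ k - n ^ k) ^ m := by
        simp only [card_satBy, sum_const, card_univ, Fintype.card_fun, Fintype.card_bool,
          Fintype.card_fin, smul_eq_mul]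

/-- Size of the instance space: `#Ω = ((2n)^k)^m`. -/
theorem card_inst (k n m : ℕ) : Fintype.card (Fin m → Fin k → Fin n × Bool) = ((2 * n) ^ k) ^ m := by
  rw [Fintype.card_fun, Fintype.card_fun, Fintype.card_prod, Fintype.card_fin, Fintype.card_bool,
    Fintype.card_fin, Fintype.card_fin, mul_comm n 2]

/-- FIRST-MOMENT BOUND on the satisfaction probability: `satProb k n m ≤ 2^n · (1 - 2^{-k})^m`
for `n ≥ 1`. -/
theorem satProb_le (k : ℕ) {n : ℕ} (hn : 1 ≤ n) (m : ℕ) :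
    satProb k n m ≤ 2 ^ n * (1 - (1 / 2 : ℝ) ^ k) ^ m := by
  unfold satProb
  have hn' : (0 : ℝ) < n := by exact_mod_cast hn
  have hΩ : (Fintype.card (Fin m → Fin k → Fin n × Bool) : ℝ) = ((2 * (n : ℝ)) ^ k) ^ m := by
    rw [card_inst]; push_cast; ring
  have hΩpos : (0 : ℝ) < ((2 * (n : ℝ)) ^ k) ^ m := by positivity
  rw [hΩ, div_le_iff₀ hΩpos]
  have hle : n ^ k ≤ (2 * n) ^ k := Nat.pow_le_pow_left (by omega) k
  have hq : ((2 * (n : ℝ)) ^ k - (n : ℝ) ^ k) = (1 - (1 / 2 : ℝ) ^ k) * (2 * (n : ℝ)) ^ k := by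
    rw [sub_mul, one_mul, ← mul_pow]
    ring
  calc ((univ.filter fun Φ : Fin m → Fin k → Fin n × Bool =>
          ∃ σ : Fin n → Bool, ∀ i, ∃ j, σ (Φ i j).1 = (Φ i j).2).card : ℝ)
      ≤ ((2 ^ n * ((2 * n) ^ k - n ^ k) ^ m : ℕ) : ℝ) := by exact_mod_cast card_sat_le k n m
    _ = 2 ^ n * ((2 * (n : ℝ)) ^ k - (n : ℝ) ^ k) ^ m := by push_cast [Nat.cast_sub hle]; ring
    _ = 2 ^ n * (1 - (1 / 2 : ℝ) ^ k) ^ m * ((2 * (n : ℝ)) ^ k) ^ m := by rw [hq, mul_pow]; ring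

/-- The first-moment bound tends to `0` along `m = ⌊α n⌋₊` as soon as `α ≥ 2^k log 2` (`k ≥ 1`):
eventually `satProb k n ⌊α n⌋₊ < ε`. -/
theorem satProb_eventually_lt (k : ℕ) (hk : 1 ≤ k) {α : ℝ} (hα : 2 ^ k * Real.log 2 ≤ α)
    {ε : ℝ} (hε : 0 < ε) : ∀ᶠ n : ℕ in atTop, satProb k n ⌊α * n⌋₊ < ε := by
  -- `q = 1 - 2^{-k} ∈ (0, 1)`, `r = 2 q^α ∈ [0, 1)`
  set q : ℝ := 1 - (1 / 2 : ℝ) ^ k with hqdef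
  have hhalf : (1 / 2 : ℝ) ^ k ≤ 1 / 2 := by
    calc (1 / 2 : ℝ) ^ k ≤ (1 / 2 : ℝ) ^ 1 := pow_le_pow_of_le_one (by norm_num) (by norm_num) hk
      _ = 1 / 2 := pow_one _
  have hhalfpos : (0 : ℝ) < (1 / 2 : ℝ) ^ k := by positivity
  have hq0 : 0 < q := by rw [hqdef]; linarith
  have hq1 : q < 1 := by rw [hqdef]; linarith
  have hlog2 : 0 < Real.log 2 := Real.log_pos (by norm_num)
  have hαpos : 0 < α := lt_of_lt_of_le (by positivity) hα
  -- `q^α < 1/2`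
  have hqexp : q < Real.exp (-(1 / 2 : ℝ) ^ k) := by
    have := Real.add_one_lt_exp (x := -(1 / 2 : ℝ) ^ k) (by linarith)
    rw [hqdef]; linarith
  have hqα : q ^ α < 1 / 2 := by
    have h1 : q ^ α < (Real.exp (-(1 / 2 : ℝ) ^ k)) ^ α := Real.rpow_lt_rpow hq0.le hqexp hαpos
    have h2 : (Real.exp (-(1 / 2 : ℝ) ^ k)) ^ α = Real.exp (-(1 / 2 : ℝ) ^ k * α) := by
      rw [← Real.exp_mul]
    have h3 : -(1 / 2 : ℝ) ^ k * α ≤ -Real.log 2 := by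
      have h4 : (1 / 2 : ℝ) ^ k * (2 ^ k * Real.log 2) ≤ (1 / 2 : ℝ) ^ k * α :=
        mul_le_mul_of_nonneg_left hα hhalfpos.le
      have h5 : (1 / 2 : ℝ) ^ k * (2 ^ k * Real.log 2) = Real.log 2 := by
        rw [← mul_assoc, ← mul_pow]; norm_num
      linarith
    have h6 : Real.exp (-(1 / 2 : ℝ) ^ k * α) ≤ 1 / 2 := by
      calc Real.exp (-(1 / 2 : ℝ) ^ k * α) ≤ Real.exp (-Real.log 2) := Real.exp_le_exp.2 h3
        _ = 1 / 2 := by rw [Real.exp_neg, Real.exp_log (by norm_num)]; norm_num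
    linarith [h1.trans_le (h2 ▸ h6)]
  set r : ℝ := 2 * q ^ α with hrdef
  have hr0 : 0 ≤ r := by rw [hrdef]; positivity
  have hr1 : r < 1 := by rw [hrdef]; linarith
  -- `r^n / q → 0`
  have hlim : Tendsto (fun n : ℕ => r ^ n / q) atTop (nhds 0) := by
    simpa using (tendsto_pow_atTop_nhds_zero_of_lt_one hr0 hr1).div_const q
  have hsmall : ∀ᶠ n : ℕ in atTop, r ^ n / q < ε := (tendsto_order.1 hlim).2 ε hε
  filter_upwards [hsmall, eventually_ge_atTop 1] with n hn hn1
  -- chain: satProb ≤ 2^n q^m ≤ 2^n q^(αn-1) = r^n / q < ε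
  have hb := satProb_le k hn1 ⌊α * n⌋₊
  have hm : α * n - 1 ≤ (⌊α * n⌋₊ : ℝ) := by linarith [Nat.lt_floor_add_one (α * n)]
  have hpow : q ^ ⌊α * n⌋₊ ≤ q ^ (α * n - 1) := by
    rw [← Real.rpow_natCast]
    exact Real.rpow_le_rpow_of_exponent_ge hq0 hq1.le hm
  have hsplit : q ^ (α * n - 1) = (q ^ α) ^ n / q := by
    rw [Real.rpow_sub_one hq0.ne', Real.rpow_mul_natCast hq0.le]
  have h2n : (0 : ℝ) ≤ 2 ^ n := by positivity
  calc satProb k n ⌊α * n⌋₊ ≤ 2 ^ n * q ^ ⌊α * n⌋₊ := hb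
    _ ≤ 2 ^ n * q ^ (α * n - 1) := mul_le_mul_of_nonneg_left hpow h2n
    _ = r ^ n / q := by rw [hsplit, hrdef, mul_pow]; ring
    _ < ε := hn

/-- UPPER EDGE OF THE WINDOW: no `(k, α)` with `α ≥ 2^k · log 2` (`k ≥ 1`) witnesses the crux —
the positive-satisfiability conjunct fails by the first-moment bound. -/
theorem posSatConjunct_false_of_firstMoment (k : ℕ) (hk : 1 ≤ k) {α : ℝ}
    (hα : 2 ^ k * Real.log 2 ≤ α) : ¬ PosSatConjunct k α := by
  rintro ⟨ε, hε, hev⟩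
  obtain ⟨n, hn1, hn2⟩ := (hev.and (satProb_eventually_lt k hk hα hε)).exists
  have := hn1 _ rfl
  linarith

theorem searchHardWindowAt_false_of_firstMoment (k : ℕ) (hk : 1 ≤ k) {α : ℝ}
    (hα : 2 ^ k * Real.log 2 ≤ α) : ¬ SearchHardWindowAt k α :=
  fun h => posSatConjunct_false_of_firstMoment k hk hα h.1

/-- Summary of §B: every witness `(k, α)` of the crux has `1 ≤ k` and `0 < α < 2^k · log 2`. -/
theorem window_of_searchHardWindowAt {k : ℕ} {α : ℝ} (h : SearchHardWindowAt k α) :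
    1 ≤ k ∧ 0 < α ∧ α < 2 ^ k * Real.log 2 := by
  have hk : 1 ≤ k := by
    rcases Nat.eq_zero_or_pos k with rfl | hk
    · exact absurd h (searchHardWindowAt_zero_false α)
    · exact hk
  refine ⟨hk, ?_, ?_⟩
  · by_contra hα
    exact searchHardWindowAt_false_of_nonpos k (not_lt.1 hα) h
  · by_contra hα
    exact searchHardWindowAt_false_of_firstMoment k hk (not_lt.1 hα) h

/-- `2^k ≤ k^5` for `2 ≤ k ≤ 22` (and it fails from `k = 23` on). -/
theorem two_pow_le_pow_five {k : ℕ} (h2 : 2 ≤ k) (h22 : k ≤ 22) : 2 ^ k ≤ k ^ 5 := by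
  interval_cases k <;> norm_num

/-- LINE A's DENSITY NEEDS `k ≥ 23`: at `α_k = 5 · 2^k · log k / k` the crux body is false for
every `k ≤ 22` (`k = 0, 1`: `α_k = 0`; `2 ≤ k ≤ 22`: `α_k ≥ 2^k log 2` since `k^5 ≥ 2^k`). -/
theorem lineA_density_false_of_le_22 {k : ℕ} (hk : k ≤ 22) :
    ¬ SearchHardWindowAt k (5 * 2 ^ k * Real.log k / k) := by
  rcases Nat.lt_or_ge k 2 with h2 | h2
  · apply searchHardWindowAt_false_of_nonpos
    interval_cases k <;> simp
  · apply searchHardWindowAt_false_of_firstMoment k (by omega)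
    have hkpos : (0 : ℝ) < k := by exact_mod_cast (show 0 < k by omega)
    have hnat : (2 : ℝ) ^ k ≤ (k : ℝ) ^ 5 := by exact_mod_cast two_pow_le_pow_five h2 hk
    have hlog : Real.log ((2 : ℝ) ^ k) ≤ Real.log ((k : ℝ) ^ 5) :=
      Real.log_le_log (by positivity) hnat
    rw [Real.log_pow, Real.log_pow] at hlog
    push_cast at hlog
    rw [le_div_iff₀ hkpos]
    have h2k : (0 : ℝ) < 2 ^ k := by positivity
    nlinarith

/-- Contrapositive form for the lead: a proof of the crux through Line A's density runs at `k ≥ 23`. -/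
theorem lineA_witness_k_ge_23 {k : ℕ} (h : SearchHardWindowAt k (5 * 2 ^ k * Real.log k / k)) :
    23 ≤ k := by
  by_contra hk
  exact lineA_density_false_of_le_22 (by omega) h

/-! ### Tightness of the decay: the trivial algorithm -/

/-- The constant word function `fun _ => []` (answer the all-`false` table) is polynomial-time
(tree: `const_mem_FP`). -/
theorem isPolyTime_const_nil : IsPolyTime (fun _ : List Bool => ([] : List Bool)) :=
  polyTimeComputable_iff_nonempty.1 (const_mem_FP [])

/-- The all-`false` table solves `Φ` iff the all-`false` ASSIGNMENT satisfies `Φ`; so its success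
count is the fixed-assignment count `((2n)^k - n^k)^m` of the first moment. -/
theorem card_solve_const_nil (k n m : ℕ) :
    (univ.filter fun Φ : Fin m → Fin k → Fin n × Bool => ∀ i, ∃ j,
      ((fun _ : List Bool => ([] : List Bool)) (encodingCNF.encode (List.ofFn fun a =>
        List.ofFn fun b => (((Φ a b).1 : ℕ), (Φ a b).2)))).getD (Φ i j).1 false = (Φ i j).2).card =
      ((2 * n) ^ k - n ^ k) ^ m := by
  rw [← card_satBy k n m (fun _ => false)]
  congr 1

/-- TIGHTNESS OF THE HARDNESS CONJUNCT: the trivial poly-time algorithm already succeeds with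
probability EXACTLY `(1 - 2^{-k})^m` (`n ≥ 1`).  Hence no proof of the crux can establish a decay
of `Pr[f solves]` faster than `(1 - 2^{-k})^{⌊αn⌋}` uniformly in poly-time `f`, and the whole
content of `SearchHardWindow` lives in the factor `2^n` between this lower bound and the
first-moment upper bound `satProb ≤ 2^n (1 - 2^{-k})^m` (`satProb_le`): inside the window both
are compatible (`α < 2^k log 2`). -/
theorem solveProb_const_nil (k : ℕ) {n : ℕ} (hn : 1 ≤ n) (m : ℕ) :
    solveProb k n m (fun _ => []) = (1 - (1 / 2 : ℝ) ^ k) ^ m := by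
  unfold solveProb
  have hn' : (0 : ℝ) < n := by exact_mod_cast hn
  have hΩ : (Fintype.card (Fin m → Fin k → Fin n × Bool) : ℝ) = ((2 * (n : ℝ)) ^ k) ^ m := by
    rw [card_inst]; push_cast; ring
  have hΩpos : (0 : ℝ) < ((2 * (n : ℝ)) ^ k) ^ m := by positivity
  rw [hΩ, div_eq_iff hΩpos.ne', card_solve_const_nil]
  have hle : n ^ k ≤ (2 * n) ^ k := Nat.pow_le_pow_left (by omega) k
  have hq : ((2 * (n : ℝ)) ^ k - (n : ℝ) ^ k) = (1 - (1 / 2 : ℝ) ^ k) * (2 * (n : ℝ)) ^ k := by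
    rw [sub_mul, one_mul, ← mul_pow]
    ring
  push_cast [Nat.cast_sub hle]
  rw [hq, mul_pow]

/-- Consequently the hardness conjunct FAILS for any claimed rate below the trivial one: at every
`(k, α)` and every `n ≥ 1` some poly-time `f` has `solveProb ≥ (1 - 2^{-k})^{⌊αn⌋₊}`. -/
theorem exists_polyTime_solveProb_ge (k : ℕ) (α : ℝ) {n : ℕ} (hn : 1 ≤ n) :
    ∃ f : List Bool → List Bool, IsPolyTime f ∧
      (1 - (1 / 2 : ℝ) ^ k) ^ ⌊α * n⌋₊ ≤ solveProb k n ⌊α * n⌋₊ f :=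
  ⟨fun _ => [], isPolyTime_const_nil, (solveProb_const_nil k hn _).ge⟩

/-! ## §C Load-bearing hypotheses: the positive-satisfiability conjunct -/

/-- Without the positive-satisfiability conjunct the hardness conjunct is TRIVIALLY satisfiable:
at `k = 0`, `α = 1` (so `m = n ≥ 1`) no word function solves any instance. -/
theorem hardnessConjunct_zero_one : HardnessConjunct 0 1 := by
  intro f _ ε hε
  refine Filter.eventually_atTop.2 ⟨1, fun n hn m hm => ?_⟩
  have hm' : m = n := by rw [hm, one_mul, Nat.floor_natCast]
  obtain ⟨m', rfl⟩ : ∃ m', m = m' + 1 := ⟨m - 1, by omega⟩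
  rw [solveProb_zero_succ]
  exact hε.le

/-- The crux with its first conjunct dropped. -/
def SearchHardWindowWithoutPosSat : Prop :=
  ∃ (k : ℕ) (α : ℝ), HardnessConjunct k α

/-- … holds for the degenerate reason `k = 0`: the sat conjunct is what excludes junk witnesses. -/
theorem searchHardWindowWithoutPosSat_trivial : SearchHardWindowWithoutPosSat :=
  ⟨0, 1, hardnessConjunct_zero_one⟩

/-! ## §C' Load-bearing hypotheses: the polynomial-time bound -/

/-- Clause-wise satisfaction of a clause list over `ℕ` by a total table `τ`. -/
def SatBy (φ : CNF ℕ) (τ : ℕ → Bool) : Prop :=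
  ∀ c ∈ φ, ∃ l ∈ c, τ l.1 = l.2

/-- A strict upper bound on the variables occurring in a clause list. -/
def varBound (φ : CNF ℕ) : ℕ :=
  φ.flatten.foldr (fun l b => max (l.1 + 1) b) 0

theorem lt_foldr_of_mem {ls : List (Literal ℕ)} {l : Literal ℕ} (h : l ∈ ls) :
    l.1 < ls.foldr (fun l b => max (l.1 + 1) b) 0 := by
  induction ls with
  | nil => cases h
  | cons hd tl ih =>
    simp only [List.foldr_cons]
    rcases List.mem_cons.1 h with rfl | h
    · exact lt_of_lt_of_le (Nat.lt_succ_self _) (le_max_left _ _)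
    · exact lt_of_lt_of_le (ih h) (le_max_right _ _)

theorem lt_varBound {φ : CNF ℕ} {c : Clause ℕ} {l : Literal ℕ} (hc : c ∈ φ) (hl : l ∈ c) :
    l.1 < varBound φ :=
  lt_foldr_of_mem (List.mem_flatten.2 ⟨c, hc, hl⟩)

/-- The (noncomputable, choice-function) BRUTE-FORCE SOLVER: on the code of a satisfiable clause
list it answers the table of a satisfying assignment, long enough to cover every variable. -/
def bruteForce (w : List Bool) : List Bool :=
  if h : ∃ φ : CNF ℕ, encodingCNF.encode φ = w ∧ ∃ τ : ℕ → Bool, SatBy φ τ then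
    List.ofFn (n := varBound (Classical.choose h))
      (fun i => Classical.choose (Classical.choose_spec h).2 i)
  else []

theorem bruteForce_eq {w : List Bool}
    (h : ∃ φ : CNF ℕ, encodingCNF.encode φ = w ∧ ∃ τ : ℕ → Bool, SatBy φ τ) :
    ∃ φ : CNF ℕ, ∃ τ : ℕ → Bool, encodingCNF.encode φ = w ∧ SatBy φ τ ∧
      bruteForce w = List.ofFn (n := varBound φ) (fun i => τ i) := by
  unfold bruteForce
  rw [dif_pos h]
  exact ⟨_, _, (Classical.choose_spec h).1, Classical.choose_spec (Classical.choose_spec h).2, rfl⟩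

/-- `bruteForce` solves every satisfiable clause list (injectivity of `encodingCNF`). -/
theorem bruteForce_solves {φ : CNF ℕ} (hφ : ∃ τ : ℕ → Bool, SatBy φ τ) :
    ∃ τ : ℕ → Bool, SatBy φ τ ∧
      ∀ c ∈ φ, ∀ l ∈ c, (bruteForce (encodingCNF.encode φ)).getD l.1 false = τ l.1 := by
  obtain ⟨φ', τ, henc, hsat, heq⟩ := bruteForce_eq (w := encodingCNF.encode φ) ⟨φ, rfl, hφ⟩
  obtain rfl : φ' = φ := encodingCNF.encode_injective henc
  refine ⟨τ, hsat, fun c hc l hl => ?_⟩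
  have hlt : l.1 < varBound φ' := lt_varBound hc hl
  rw [heq]
  simp [List.getD_eq_getElem?_getD, hlt]

/-- `Pr[satisfiable] ≤ Pr[bruteForce solves]` (in fact equality). -/
theorem satProb_le_solveProb_bruteForce (k n m : ℕ) :
    satProb k n m ≤ solveProb k n m bruteForce := by
  unfold satProb solveProb
  refine div_le_div_of_nonneg_right ?_ (Nat.cast_nonneg _)
  refine Nat.cast_le.2 (card_le_card fun Φ hΦ => ?_)
  simp only [mem_filter, mem_univ, true_and] at hΦ ⊢
  obtain ⟨σ, hσ⟩ := hΦ
  set L : CNF ℕ := List.ofFn fun a => List.ofFn fun b => (((Φ a b).1 : ℕ), (Φ a b).2) with hL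
  have hsat : ∃ τ : ℕ → Bool, SatBy L τ := by
    refine ⟨fun v => if hv : v < n then σ ⟨v, hv⟩ else false, fun c hc => ?_⟩
    rw [hL] at hc
    obtain ⟨a, rfl⟩ := List.mem_ofFn.1 hc
    obtain ⟨b, hb⟩ := hσ a
    refine ⟨(((Φ a b).1 : ℕ), (Φ a b).2), List.mem_ofFn.2 ⟨b, rfl⟩, ?_⟩
    simp [hb]
  obtain ⟨τ, hτ, hget⟩ := bruteForce_solves hsat
  intro i
  have hci : (List.ofFn fun b => (((Φ i b).1 : ℕ), (Φ i b).2)) ∈ L := by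
    rw [hL]; exact List.mem_ofFn.2 ⟨i, rfl⟩
  obtain ⟨l, hl, hval⟩ := hτ _ hci
  obtain ⟨j, rfl⟩ := List.mem_ofFn.1 hl
  exact ⟨j, by rw [hget _ hci _ hl]; exact hval⟩

/-- The crux with the time bound dropped (hardness demanded of ALL word functions). -/
def SearchHardWindowWithoutPolyTime : Prop :=
  ∃ (k : ℕ) (α : ℝ), PosSatConjunct k α ∧
    ∀ f : List Bool → List Bool, ∀ ε : ℝ, 0 < ε →
      ∀ᶠ n : ℕ in atTop, ∀ m : ℕ, m = ⌊α * n⌋₊ → solveProb k n m f ≤ ε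

/-- ANY PROOF MUST USE THE TIME BOUND: without `IsPolyTime` the crux is false — the brute-force
solver succeeds with probability `≥ Pr[sat] ≥ ε`, contradicting success `→ 0`. (This is the
formal shadow of the route's relativization caveat: only white-box use of `f`'s running time can
separate `f` from `bruteForce`.) -/
theorem searchHardWindow_false_without_polyTime : ¬ SearchHardWindowWithoutPolyTime := by
  rintro ⟨k, α, ⟨ε, hε, hsat⟩, hhard⟩
  obtain ⟨n, hn1, hn2⟩ := (hsat.and (hhard bruteForce (ε / 2) (half_pos hε))).exists
  have h1 := hn1 _ rfl
  have h2 := hn2 _ rfl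
  have h3 := satProb_le_solveProb_bruteForce k n ⌊α * n⌋₊
  linarith

/-! ## §D Line `Sketch` (Line A, approx-degree ladder) — Targets

Stub census of the picked line (lead `prover-line-stmt-PneNP-2460-0`, skeleton `Lines/Sketch.lean`):
* `stub_strongLowDegreeHardness : HuangSellke2025KSat` — NAMED FACT. Checked against the paper
  (arXiv:2501.06427): Cor. 3.21 (p. 23) "for any κ > κ* ≈ 4.911 … k ≥ k*(κ), α = κ 2^k log k/k:
  if A° is a degree D = o(N) function with E‖A°(y, ω)‖² ≤ CN then P[round_U(A°) satisfies y] =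
  o_N(1)"; "degree D function" on Γ^{kM} = span of `∏_{i ∈ I} f_i(y_i)`, `|I| ≤ D` (p. 21) =
  `IsCoordDegreeLE`; `round_U(x) = 1 iff x ≥ U`, `U ~ Unif[-1,1]` (p. 4), so on `{∀ v, |F v| ≥ 1}`
  the rounding IS the sign for a.e. `U`: the typed fact is the deterministic saturated special
  case, typed ≤ printed. NOT ATTACKABLE (and in the unsatisfiable range k ≤ 22 it is even trivial).
* `stub_polyTimeLowDegreeSimulable` (KERNEL) — its hypothesis is refuted by `HardnessConjunct k α`
  (`kernelHypothesis_false_of_hardness` below): kernel ⟸ crux-hardness; with the fact, kernel ⟺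
  crux-hardness. For `3 ≤ k ≤ 22` the kernel is vacuous for the cheaper reason of §B (first moment:
  nothing is solvable with probability ≥ ε at α_k). No attack surface of its own.
* `stub_lineAComposition` — already kernel-checked in the skeleton (`SearchHardWindow_of`): the
  stubs ARE jointly sufficient, nothing is smuggled (the composition only uses `Frequently ∧
  Eventually` at a common index and `#Ω ≥ 1`).
* `stub_truncationSurrogate`, `stub_acTailBound` — landed (p103419, p103257).
* `stub_rungAssembly` / `stub_acZeroRung` / `stub_acZeroRungPow` / `stub_decisionTreeRung` —
  positive consequences of the fact; corners checked on paper: `c = 0` (size ≤ 1: constants and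
  single input bits) and `d = 0` still give success `(1 - 2^{-k})^m → 0` resp. `≤ 1/n`-type
  events, consistent; `litArrayOfBits` is a bijection bits ↔ literal arrays at `n = 2^j`
  (`finProdFinEquiv` twice, `finFunctionFinEquiv`), so the cube IS `F_k(2^j, m)`. No refutation.

Why the crux resists (for the record): refuting `SearchHardWindow` needs, for EVERY `(k, α)` in
the window of §B with uniformly positive satisfiability, a polynomial-time word function solving
`F_k(n, ⌊αn⌋)` with probability `≥ δ` infinitely often; at the intended witness
`α = 5·2^k log k/k`, `k ≥ 23`, "the best algorithm known … finds a satisfying assignment up to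
clause density (1 - o_k(1)) 2^k log k / k" (Huang–Sellke 2025 p. 23 citing Coja-Oghlan 2010), a
factor 5 short. Conversely the crux implies `P ≠ NP` (route `closes`). -/

/-- The HYPOTHESIS of the kernel stub `stub_polyTimeLowDegreeSimulable` — frequent success `≥ ε`
of a poly-time `f` at density `α` — is refuted by the crux's hardness conjunct at the same
`(k, α)`. Hence the kernel (whatever its conclusion) is a corollary of `HardnessConjunct k α_k`,
and modulo `HuangSellke2025KSat` it is EQUIVALENT to it (converse: `SearchHardWindow_of` in
`Lines/Sketch.lean`): it has no attack surface independent of the crux. -/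
theorem kernelHypothesis_false_of_hardness {k : ℕ} {α : ℝ} (h : HardnessConjunct k α)
    {f : List Bool → List Bool} (hf : IsPolyTime f) {ε : ℝ} (hε : 0 < ε)
    (hfreq : ∃ᶠ n : ℕ in atTop, ∀ m : ℕ, m = ⌊α * n⌋₊ →
      ε * Fintype.card (Fin m → Fin k → Fin n × Bool) ≤
        ((univ.filter fun Φ : Fin m → Fin k → Fin n × Bool => ∀ i, ∃ j,
            (f (encodingCNF.encode (List.ofFn fun a => List.ofFn fun b =>
              (((Φ a b).1 : ℕ), (Φ a b).2)))).getD (Φ i j).1 false = (Φ i j).2).card : ℝ)) :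
    False := by
  have hev := h f hf (ε / 2) (half_pos hε)
  obtain ⟨n, hn1, hn2, hn3⟩ := (hfreq.and_eventually (hev.and (eventually_ge_atTop 1))).exists
  have h1 := hn1 _ rfl
  have h2 := hn2 _ rfl
  unfold solveProb at h2
  have hcard : (1 : ℝ) ≤ Fintype.card (Fin ⌊α * n⌋₊ → Fin k → Fin n × Bool) := by
    have : Nonempty (Fin ⌊α * n⌋₊ → Fin k → Fin n × Bool) := ⟨fun _ _ => (⟨0, hn3⟩, true)⟩
    exact_mod_cast Fintype.card_pos
  rw [div_le_iff₀ (by linarith)] at h2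
  have h4 := h1.trans h2
  have h5 : 0 < ε * Fintype.card (Fin ⌊α * n⌋₊ → Fin k → Fin n × Bool) := by positivity
  nlinarith

end Summit.PneNP.PneNP.Cruxes.SearchHardWindow.Disproof

end
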